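import Summits.CriticalPhenomena.SAWScalingLimit.Theses.SAWExpCovariance
import HarnessLib

/-!
# Route `SAWExpCovariance`: the assembly item `Assembly` (stmt-CriticalPhenomena-11373)

The assembly item of route SAWExpCovariance (rev 8, cone repair of 2026-08-15) is the implication

  `Assembly := ExpCovariance → DiscContinuity → DensityTheorem → LimitAxioms → LimitExists →
    CarrierDependence → LSWRestrictionFact83 → SAWScalingLimit`,

i.e. exactly the type of the route's deciding theorem `closes` (glue over the tree: `LimitExists`
gives the scaling-limit family `P`, chordal with `(lim)`; `LimitAxioms` gives restriction,
translation/dilation covariance and simplicity; `CarrierDependence`, `ExpCovariance` and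
`DiscContinuity` feed `DensityTheorem`, which returns conformal covariance of `P`; the shared
hypothesis-free LSW03 item `LSWRestrictionFact83` identifies every `P D` as the chordal
`SLE_{8/3}` law; `integral_map` turns `(lim)` into `ConvergesInLawToSLE (8/3)`).  The item
therefore closes by the term `closes`; this file records that, kernel-checked against the live
route declarations.  No new definitions, no named-fact hypotheses.

## References

* G. F. Lawler, O. Schramm, W. Werner, *Conformal restriction: the chordal case*,
  J. Amer. Math. Soc. 16 (2003), 917–955, arXiv:math/0209343, p. 5 result 2
  [LawlerSchrammWerner2003Restriction].
* G. F. Lawler, O. Schramm, W. Werner, *On the scaling limit of planar self-avoiding walk*,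
  Proc. Sympos. Pure Math. 72, Part 2 (2004), 339–364, arXiv:math/0204277
  [LawlerSchrammWerner2004SAW].
-/

noncomputable section

namespace Summit.CriticalPhenomena.SAWScalingLimit.Theorems

open Summit.CriticalPhenomena.SAWScalingLimit.Theses.SAWExpCovariance

/-- **Item `Assembly` (stmt-CriticalPhenomena-11373) of route SAWExpCovariance holds.**
The five cruxes `ExpCovariance`, `DiscContinuity`, `DensityTheorem`, `LimitAxioms`,
`LimitExists`, the support item `CarrierDependence` and the shared hypothesis-free LSW03 item
`LSWRestrictionFact83` together imply the sub-problem statement `SAWScalingLimit`: this is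
literally the type of the route's deciding theorem `closes`, which is the proof.
[cite: LawlerSchrammWerner2003Restriction, p. 5 result 2; LawlerSchrammWerner2004SAW] -/
theorem sawExpCovariance_assembly_proof :
    Summit.CriticalPhenomena.SAWScalingLimit.Theses.SAWExpCovariance.Assembly := by
  unfold Summit.CriticalPhenomena.SAWScalingLimit.Theses.SAWExpCovariance.Assembly
  exact closes

end Summit.CriticalPhenomena.SAWScalingLimit.Theorems
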